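import Mathlib
import Literature.Analysis.FluidPDE.VectorCalculus

/-!
# The TILT cokernel direction pairs with the rate column at `(2/3)ℓ³‖e₃ × d‖²` — affine-model algebra and the two interval integrals
# (crux `Clause13RNearStraightL`, stmt-NavierStokesRegularity-23612; line `rate_bordered_split`, STUB R `stub_rateRow13RFlat`)

Route `FilamentSkeletonRss`, Variant A1R.  Companion of `…Clause13RScalingAnnihilator` (§2: the SCALING mode's pairing with the rate column is affine
in `τ`, hence blind to the column's linear part) and of `…Clause13RCokernelCertificate` (cokernel certificate ⟹ STUB R).  The memo
STRUCTURE-23612-conformal-cokernel-leafhand8-g1.md (evidence #29/#30 on 23612) identifies the cokernel direction that DOES see the column: the TILT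
mode `K = −τ·(d × ρ₁)`, `ρ₁ = e₃ × d`, whose Marsden–Weinstein representative is `ψ = d × K = τ·ρ₁`.  THIS FILE records the affine-model numbers
kernel-checked (unit tangent `d`, affine filament `x = p + τ•d`):

* `cross_cross_rho` — `d × (d × ρ₁) = −ρ₁` for `ρ₁ = e₃ × d`, `‖d‖ = 1` (so `ψ = τ•ρ₁`);
* `tiltMode_pairing_density` — `⟪τ•ρ₁, e₃×x − ⟪e₃×x, d⟫d⟫ = τ·⟪ρ₁, e₃×p⟫ + τ²·‖ρ₁‖²` (the projector drops: `ρ₁ ⊥ d`);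
* `integral_odd_add_sq` — `∫_{−ℓ}^{ℓ} (aτ + Bτ²) dτ = (2/3)·B·ℓ³`; `integral_abs_symm` — `∫_{−ℓ}^{ℓ} |τ| dτ = ℓ²` (`0 ≤ ℓ`);
* `tiltMode_pairing_integral` — **`∫_{−ℓ}^{ℓ} ⟪τ•ρ₁, R(τ)⟫ dτ = (2/3)‖e₃ × d‖²·ℓ³`** and `tiltMode_mass` — `∫_{−ℓ}^{ℓ} ‖τ•ρ₁‖ dτ = ‖e₃ × d‖·ℓ²`; with the
  tilt floor `‖e₃ × d‖² ≥ θ₀(2−θ₀)` of `…Clause13RRateColumnFloor.norm_cross_single_two_sq_ge` the pairing-to-mass ratio is `(2/3)ℓ‖e₃×d‖ ≥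
  (2/3)ℓ√(θ₀(2−θ₀))` — against the `√Γ/cnd` floor the certificate needs, this is the margin `≍ R_b√(log Γ)·√(θ₀(2−θ₀))` quoted in the memo
  (exact cokernel elements are `O(ε) + O(1/log Γ)` corrections of this affine tilt mode; model numerics: ratio `0.655–0.677·ℓ‖ρ₁‖` for
  `ε = ℓ²/A ≤ 0.5`).

Hand `leafhand-ns-filamentskeletonrs-8-g1` (LAND-ONLY); `--supports stmt-NavierStokesRegularity-23612` helper.  HONEST FRAMING: vector algebra and two
elementary integrals about an AFFINE MODEL of a HYPOTHETICAL filament skeleton on the NEGATIVE side of a MODEL blow-up route; STUB R is NOT proved here and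
nothing in this file bears on Navier–Stokes regularity or blow-up.
-/

noncomputable section

open scoped InnerProductSpace
open Literature.Analysis.FluidPDE intervalIntegral

namespace Summit.NavierStokesRegularity.NavierStokesRegularity.Theorems.Clause13RTiltModePairing
set_option linter.dupNamespace false

/-- `d × (d × ρ₁) = −ρ₁` for `ρ₁ = e₃ × d` and unit `d` (`ρ₁ ⊥ d`). [folklore] -/
theorem cross_cross_rho (d : EuclideanSpace ℝ (Fin 3)) (hd : ‖d‖ = 1) :
    cross d (cross d (cross (EuclideanSpace.single 2 1) d)) = -cross (EuclideanSpace.single 2 1) d := by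
  have hdd : ⟪d, d⟫_ℝ = 1 := by rw [real_inner_self_eq_norm_sq, hd, one_pow]
  have key : ∀ a b v : EuclideanSpace ℝ (Fin 3),
      cross a (cross b v) = ⟪a, v⟫_ℝ • b - ⟪a, b⟫_ℝ • v := by
    intro a b v
    ext i
    fin_cases i <;>
      simp [cross, cross_apply, PiLp.inner_apply, Fin.sum_univ_three, Matrix.cons_val_zero, Matrix.cons_val_one,
        Matrix.cons_val_two, Matrix.head_cons, Matrix.tail_cons] <;> ring
  have horth : ⟪d, cross (EuclideanSpace.single 2 1) d⟫_ℝ = 0 := by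
    simp only [cross, cross_apply, PiLp.inner_apply, RCLike.inner_apply, conj_trivial, Fin.sum_univ_three,
      Matrix.cons_val_zero, Matrix.cons_val_one, Matrix.cons_val_two, Matrix.head_cons, Matrix.tail_cons, PiLp.single_apply]
    simp only [Fin.isValue, Fin.reduceEq, ↓reduceIte, zero_mul, sub_zero, zero_sub]
    ring
  rw [key d d, horth, hdd, zero_smul, one_smul, zero_sub]

/-- **Tilt-mode pairing density along the affine model**: with `ρ₁ = e₃ × d` (any `d`; `ρ₁ ⊥ d` automatically), `x = p + τ•d`,
`⟪τ•ρ₁, e₃×x − ⟪e₃×x, d⟫d⟫ = τ⟪ρ₁, e₃×p⟫ + τ²‖ρ₁‖²`. [folklore] -/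
theorem tiltMode_pairing_density (p d : EuclideanSpace ℝ (Fin 3)) (τ : ℝ) :
    ⟪τ • cross (EuclideanSpace.single 2 1) d,
        cross (EuclideanSpace.single 2 1) (p + τ • d) - ⟪cross (EuclideanSpace.single 2 1) (p + τ • d), d⟫_ℝ • d⟫_ℝ
      = τ * ⟪cross (EuclideanSpace.single 2 1) d, cross (EuclideanSpace.single 2 1) p⟫_ℝ
        + τ ^ 2 * ‖cross (EuclideanSpace.single 2 1) d‖ ^ 2 := by
  have horth : ⟪cross (EuclideanSpace.single 2 1) d, d⟫_ℝ = 0 := by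
    simp only [cross, cross_apply, PiLp.inner_apply, RCLike.inner_apply, conj_trivial, Fin.sum_univ_three,
      Matrix.cons_val_zero, Matrix.cons_val_one, Matrix.cons_val_two, Matrix.head_cons, Matrix.tail_cons, PiLp.single_apply]
    simp only [Fin.isValue, Fin.reduceEq, ↓reduceIte, mul_zero, zero_mul, sub_zero, zero_sub]
    ring
  have hadd : cross (EuclideanSpace.single 2 1) (p + τ • d)
      = cross (EuclideanSpace.single 2 1) p + τ • cross (EuclideanSpace.single 2 1) d := by
    rw [← crossCLM_apply, map_add, map_smul, crossCLM_apply, crossCLM_apply]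
  rw [hadd, inner_sub_right, real_inner_smul_left, real_inner_smul_left, inner_smul_right, horth, mul_zero, mul_zero, sub_zero,
    inner_add_right, inner_smul_right, real_inner_self_eq_norm_sq]
  ring

/-- `∫_{−ℓ}^{ℓ} (aτ + Bτ²) dτ = (2/3)Bℓ³`. [folklore] -/
theorem integral_odd_add_sq (a B ℓ : ℝ) : ∫ τ in (-ℓ)..ℓ, (a * τ + B * τ ^ 2) = 2 / 3 * B * ℓ ^ 3 := by
  rw [intervalIntegral.integral_add (by apply Continuous.intervalIntegrable; fun_prop)
    (by apply Continuous.intervalIntegrable; fun_prop), intervalIntegral.integral_const_mul, intervalIntegral.integral_const_mul,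
    integral_id, integral_pow]
  ring

/-- `∫_{−ℓ}^{ℓ} |τ| dτ = ℓ²` for `0 ≤ ℓ`. [folklore] -/
theorem integral_abs_symm {ℓ : ℝ} (hℓ : 0 ≤ ℓ) : ∫ τ in (-ℓ)..ℓ, |τ| = ℓ ^ 2 := by
  have hc : IntervalIntegrable (fun τ : ℝ => |τ|) MeasureTheory.volume (-ℓ) 0 :=
    (continuous_abs).intervalIntegrable _ _
  have hc' : IntervalIntegrable (fun τ : ℝ => |τ|) MeasureTheory.volume 0 ℓ :=
    (continuous_abs).intervalIntegrable _ _
  rw [← intervalIntegral.integral_add_adjacent_intervals hc hc']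
  have h1 : ∫ τ in (-ℓ)..0, |τ| = ∫ τ in (-ℓ)..0, -τ := by
    refine intervalIntegral.integral_congr fun τ hτ => ?_
    rw [Set.uIcc_of_le (by linarith)] at hτ
    exact abs_of_nonpos hτ.2
  have h2 : ∫ τ in (0:ℝ)..ℓ, |τ| = ∫ τ in (0:ℝ)..ℓ, τ := by
    refine intervalIntegral.integral_congr fun τ hτ => ?_
    rw [Set.uIcc_of_le hℓ] at hτ
    exact abs_of_nonneg hτ.1
  rw [h1, h2, intervalIntegral.integral_neg, integral_id, integral_id]
  ring

/-- **Tilt-mode pairing: `∫_{−ℓ}^{ℓ} ⟪τ•ρ₁, R(τ)⟫ dτ = (2/3)‖e₃ × d‖² ℓ³`** along the affine model (rate column `R(τ) = P_d(e₃ × (p + τd))`). [folklore] -/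
theorem tiltMode_pairing_integral (p d : EuclideanSpace ℝ (Fin 3)) (ℓ : ℝ) :
    ∫ τ in (-ℓ)..ℓ, ⟪τ • cross (EuclideanSpace.single 2 1) d,
        cross (EuclideanSpace.single 2 1) (p + τ • d) - ⟪cross (EuclideanSpace.single 2 1) (p + τ • d), d⟫_ℝ • d⟫_ℝ
      = 2 / 3 * ‖cross (EuclideanSpace.single 2 1) d‖ ^ 2 * ℓ ^ 3 := by
  simp_rw [tiltMode_pairing_density p d]
  have h := integral_odd_add_sq ⟪cross (EuclideanSpace.single 2 1) d, cross (EuclideanSpace.single 2 1) p⟫_ℝ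
    (‖cross (EuclideanSpace.single 2 1) d‖ ^ 2) ℓ
  refine (intervalIntegral.integral_congr fun τ _ => ?_).trans h
  ring

/-- **Tilt-mode mass: `∫_{−ℓ}^{ℓ} ‖τ•ρ₁‖ dτ = ‖e₃ × d‖ ℓ²`** (`0 ≤ ℓ`). [folklore] -/
theorem tiltMode_mass (d : EuclideanSpace ℝ (Fin 3)) {ℓ : ℝ} (hℓ : 0 ≤ ℓ) :
    ∫ τ in (-ℓ)..ℓ, ‖τ • cross (EuclideanSpace.single 2 1) d‖ = ‖cross (EuclideanSpace.single 2 1) d‖ * ℓ ^ 2 := by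
  simp_rw [norm_smul, Real.norm_eq_abs]
  rw [intervalIntegral.integral_mul_const, integral_abs_symm hℓ, mul_comm]

/-- **The affine tilt ratio**: pairing `= (2/3)ℓ‖e₃×d‖ ×` mass; with the tilt clause (`|⟪d, e₃⟫| ≤ 1 − θ₀`) the factor `‖e₃ × d‖` is at least
`√(θ₀(2−θ₀))` (`…Clause13RRateColumnFloor.norm_cross_single_two_sq_ge`).  Recorded as the identity between the two integrals. [folklore] -/
theorem tiltMode_pairing_eq_ratio_mul_mass (p d : EuclideanSpace ℝ (Fin 3)) {ℓ : ℝ} (hℓ : 0 ≤ ℓ) :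
    ∫ τ in (-ℓ)..ℓ, ⟪τ • cross (EuclideanSpace.single 2 1) d,
        cross (EuclideanSpace.single 2 1) (p + τ • d) - ⟪cross (EuclideanSpace.single 2 1) (p + τ • d), d⟫_ℝ • d⟫_ℝ
      = (2 / 3 * ℓ * ‖cross (EuclideanSpace.single 2 1) d‖)
        * ∫ τ in (-ℓ)..ℓ, ‖τ • cross (EuclideanSpace.single 2 1) d‖ := by
  rw [tiltMode_pairing_integral p d ℓ, tiltMode_mass d hℓ]
  ring

end Summit.NavierStokesRegularity.NavierStokesRegularity.Theorems.Clause13RTiltModePairing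

end
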